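import Summits.QuantumFields.YangMills.Theorems.FlatTubeReductionCoreLevelWeights
import Summits.QuantumFields.YangMills.Theorems.FlatTubeReductionDiagonalRatioOfLevelBounds
import Summits.QuantumFields.YangMills.Theorems.LuscherReductionTwistedTraceScalingBTWindow
import Summits.QuantumFields.YangMills.Theorems.FlatTubeReductionProfileLevelSetVolume
import HarnessLib

/-!
# The exact diagonal dressing on the CONCRETE core `S′ = {βkin ≤ T} ∩ {β‖v̂‖² ≤ T} ∩ {β‖v̂′‖² ≤ T} ∩ supp`, with the slow amplitude measured by `orbitDist u` itself:
# `|f(u)/f(1) − 1| ≤ (a₂(u) + a_q(u))·Ξ + e·(a₁(u) + a₂(u) + a_q(u))²·Ξ + η`, `a₁ ∝ orbitDist u`, `a₂ ∝ orbitDist u²`, `a_q ∝ (orbitDist u⁴ + orbitDist u)·β^{-1/2}`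
# (route `FlatTubeReduction`, crux K1 `NearFlatRatioLaw` stmt-QuantumFields-24720; seat `ym-line-ftr-p1` g13; rate twin «ratepack-v3 / frozen fibres»; R2b1 RECORD rung — no summit
# statement is proved here)

WHY (memo `Cruxes/NearFlatRatioLaw/Lines/ratepack-v3-frozen-g12.md` §6 (F8a)).  Glue of `…CoreLevelWeights` (pointwise level bounds) into `…DiagonalRatioOfLevelBounds` (the sandwich from
level bounds) on the concrete core, using the one-site facts `‖q(u_k) − 1‖ ≤ orbitDist u` (`norm_su2Quat_sub_one_le_orbitDist`), `Σ_a u⃗_{k,a}² ≤ ‖q(u_k) − 1‖²`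
(`sum_sq_vecPart_le_norm_sub_one_sq`) and `L³S₁(u) ≤ 12L³·orbitDist u⁴` (`wilsonAction_one_site_le`): no gauge representative is needed on the one-site lattice.  What remains
hypothetical is exactly the profile interface: ONE moment number `Ξ`, the tails `η`, and the integrability of the Haar moments on the core (`…DiagonalMomentMeasurability`,
`…CoreTails`, `…ReweightedProfile` discharge them from profile numbers).
  ★★★ `fpBOKernel_diag_two_sided_on_core`.
HONEST FRAMING: assembly bookkeeping; femto rung R2b1 (RECORD label); not infinite volume, not a gap, not Clay.  No defs, no named facts, no `sorry`.
-/

set_option autoImplicit false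

noncomputable section

open MeasureTheory Filter Topology Real Set
open scoped BigOperators
open Literature.MathematicalPhysics.QuantumFieldTheory
open Literature.MathematicalPhysics.QuantumLattice

namespace Summit.QuantumFields.YangMills.Theorems.FemtoTransferGap.RateTube

open Summit.QuantumFields.YangMills.Theorems.FemtoTransferGap
open Summit.QuantumFields.YangMills.Theorems.FemtoTransferGap.TwoLattice
open Summit.QuantumFields.YangMills.Theorems.FemtoTransferGap.TwoLattice.ConstTube
open Summit.QuantumFields.YangMills.Theorems.FemtoTransferGap.TwoLattice.Avg
open Summit.QuantumFields.YangMills.Theorems.FemtoTransferGap.TwoLattice.Cov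
open Summit.QuantumFields.YangMills.Theorems.FemtoTransferGap.TwoLattice.Toron
open Summit.QuantumFields.YangMills.Theorems.FemtoTransferGap.TwoLattice.Stiff (LinkSpace)

variable {L : ℕ} [NeZero L]

set_option maxHeartbeats 1600000 in
/-- ★★★ **THE EXACT DIAGONAL DRESSING ON THE CONCRETE CORE.**  `β ≥ 1`; profile `Ω` (measurable, `0 ≤ Ω ≤ CΩ`, colour-blind, supported on the cap); FP window `ε`; slow datum `u` with
`orbitDist u ≤ 1/40` and `12L³·orbitDist u⁴ < 2`; level `T ≥ 0` and fibre radius `r_T` (`βr² ≤ T ⇒ r ≤ r_T`) with `r_T + r_T ≤ 1/30` and `3L(√(T/β) + 5√2r_T + √2r_T) < 1`; the core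
`S′ = {βkin ≤ T} ∩ {β‖v̂‖² ≤ T} ∩ {β‖v̂′‖² ≤ T} ∩ {Ω(v̂) ≠ 0, Ω(v̂′) ≠ 0, fpWeight ≠ 0}`.  With `τ = orbitDist u`, `σ = 12L³τ⁴`, `c_K = |E|(24302L² + 6βε²)`, `N₃ = |P×Fin 3|`:
`a₁ = τ(24c_K + 80N₃)`, `a₂ = τ²(48c_K + 7.25·10⁷N₃) + 25σN₃ + 3456N_P√σ`, `a_q = 4N_P[σ(14688β^{-1/2} + 1401138β⁻¹) + 7·10⁵τβ^{-1/2}]`; if `(a₁ + a₂)(1 + 3T) + a_q(1 + 2T)² ≤ 1`,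
`∫_{S′}ρ₁Λ⁴ ≤ Ξ∫ρ₁`, the Haar moments and `ρ₁Λ⁴` are integrable on `S′`, and the tails are `≤ η`, then
`(1 − (a₂+a_q)Ξ − η)f(1) ≤ f(u) ≤ (1 + (a₂+a_q)Ξ + e(a₁+a₂+a_q)²Ξ + η)f(1)`. [cite: Luscher1983, §3] -/
theorem fpBOKernel_diag_two_sided_on_core {β : ℝ} (hβ : 1 ≤ β) {Ω : LinkSpace L → ℝ} (hΩm : Measurable Ω) {CΩ : ℝ} (hCΩ : ∀ x, |Ω x| ≤ CΩ) (hΩ0 : ∀ x, 0 ≤ Ω x)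
    (hΩinv : ∀ (g : SU2) (x : LinkSpace L), Ω (adL L g x) = Ω x) (hΩc : ∀ v : Edge 3 L → Fin 3 → ℝ, Ω (linkEmbed L v) ≠ 0 → v ∈ capBalancedSet L)
    (ε : ℝ) (u : GaugeConfig 3 1 SU2) (hu40 : orbitDist u ≤ 1 / 40) (hσ2 : (L : ℝ) ^ 3 * (12 * orbitDist u ^ 4) < 2)
    {T rT : ℝ} (hrT : ∀ r : ℝ, 0 ≤ r → β * r ^ 2 ≤ T → r ≤ rT) (hrT30 : rT + rT ≤ 1 / 30)
    (hsmallT : 3 * L * (Real.sqrt (T / β) + 5 * Real.sqrt 2 * rT + Real.sqrt 2 * rT) < 1)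
    (hsum : (orbitDist u * (24 * ((Fintype.card (Edge 3 L) : ℝ) * (24302 * (L : ℝ) ^ 2 + 6 * (β * ε ^ 2))) + 80 * (Fintype.card (Plaquette 3 L × Fin 3) : ℝ)) +
        (orbitDist u ^ 2 * (48 * ((Fintype.card (Edge 3 L) : ℝ) * (24302 * (L : ℝ) ^ 2 + 6 * (β * ε ^ 2))) + 72500000 * (Fintype.card (Plaquette 3 L × Fin 3) : ℝ)) +
          25 * ((L : ℝ) ^ 3 * (12 * orbitDist u ^ 4)) * (Fintype.card (Plaquette 3 L × Fin 3) : ℝ) + 3456 * (Fintype.card (Plaquette 3 L) : ℝ) * Real.sqrt ((L : ℝ) ^ 3 * (12 * orbitDist u ^ 4)))) *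
        (1 + 3 * T) +
      4 * (Fintype.card (Plaquette 3 L) : ℝ) * (((L : ℝ) ^ 3 * (12 * orbitDist u ^ 4)) * (14688 * (Real.sqrt β)⁻¹ + 1401138 * β⁻¹) + 700000 * orbitDist u * (Real.sqrt β)⁻¹) *
        (1 + 2 * T) ^ 2 ≤ 1)
    (hM₂i : IntegrableOn (fun p : (Edge 3 L → Fin 3 → ℝ) × ((Edge 3 L → Fin 3 → ℝ) × (Site 3 L → SU2)) => fpTriple L β Ω (fpWeight L ε) 1 1 p *
      ∫ d, |diagX L β (gaugeTransform (fun _ : Site 3 1 => d) u) p.1 p.2.1 p.2.2 - diagX1 L β (slowLin (gaugeTransform (fun _ : Site 3 1 => d) u)) p.1 p.2.1 p.2.2| ∂haarProbability SU2)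
      ({p : (Edge 3 L → Fin 3 → ℝ) × ((Edge 3 L → Fin 3 → ℝ) × (Site 3 L → SU2)) | β * kinDefect L (orthoTube L 1 p.1) (orthoTube L 1 p.2.1) p.2.2 ≤ T} ∩
          {p | β * ‖linkEmbed L p.1‖ ^ 2 ≤ T} ∩ {p | β * ‖linkEmbed L p.2.1‖ ^ 2 ≤ T} ∩
          {p | Ω (linkEmbed L p.1) ≠ 0 ∧ Ω (linkEmbed L p.2.1) ≠ 0 ∧ fpWeight L ε p.2.2 ≠ 0})
      ((orthoTransverse L).prod ((orthoTransverse L).prod (gaugeMeasure L))))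
    (hMRi : IntegrableOn (fun p : (Edge 3 L → Fin 3 → ℝ) × ((Edge 3 L → Fin 3 → ℝ) × (Site 3 L → SU2)) => fpTriple L β Ω (fpWeight L ε) 1 1 p *
      ∫ d, diagX L β (gaugeTransform (fun _ : Site 3 1 => d) u) p.1 p.2.1 p.2.2 ^ 2 * Real.exp |diagX L β (gaugeTransform (fun _ : Site 3 1 => d) u) p.1 p.2.1 p.2.2| ∂haarProbability SU2)
      ({p : (Edge 3 L → Fin 3 → ℝ) × ((Edge 3 L → Fin 3 → ℝ) × (Site 3 L → SU2)) | β * kinDefect L (orthoTube L 1 p.1) (orthoTube L 1 p.2.1) p.2.2 ≤ T} ∩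
          {p | β * ‖linkEmbed L p.1‖ ^ 2 ≤ T} ∩ {p | β * ‖linkEmbed L p.2.1‖ ^ 2 ≤ T} ∩
          {p | Ω (linkEmbed L p.1) ≠ 0 ∧ Ω (linkEmbed L p.2.1) ≠ 0 ∧ fpWeight L ε p.2.2 ≠ 0})
      ((orthoTransverse L).prod ((orthoTransverse L).prod (gaugeMeasure L))))
    (hΛi : IntegrableOn (fun p : (Edge 3 L → Fin 3 → ℝ) × ((Edge 3 L → Fin 3 → ℝ) × (Site 3 L → SU2)) => fpTriple L β Ω (fpWeight L ε) 1 1 p *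
      (1 + β * kinDefect L (orthoTube L 1 p.1) (orthoTube L 1 p.2.1) p.2.2 + β * ‖linkEmbed L p.1‖ ^ 2 + β * ‖linkEmbed L p.2.1‖ ^ 2) ^ 4)
      ({p : (Edge 3 L → Fin 3 → ℝ) × ((Edge 3 L → Fin 3 → ℝ) × (Site 3 L → SU2)) | β * kinDefect L (orthoTube L 1 p.1) (orthoTube L 1 p.2.1) p.2.2 ≤ T} ∩
          {p | β * ‖linkEmbed L p.1‖ ^ 2 ≤ T} ∩ {p | β * ‖linkEmbed L p.2.1‖ ^ 2 ≤ T} ∩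
          {p | Ω (linkEmbed L p.1) ≠ 0 ∧ Ω (linkEmbed L p.2.1) ≠ 0 ∧ fpWeight L ε p.2.2 ≠ 0})
      ((orthoTransverse L).prod ((orthoTransverse L).prod (gaugeMeasure L))))
    {Ξ η : ℝ}
    (hΞ : ∫ p in ({p : (Edge 3 L → Fin 3 → ℝ) × ((Edge 3 L → Fin 3 → ℝ) × (Site 3 L → SU2)) | β * kinDefect L (orthoTube L 1 p.1) (orthoTube L 1 p.2.1) p.2.2 ≤ T} ∩
          {p | β * ‖linkEmbed L p.1‖ ^ 2 ≤ T} ∩ {p | β * ‖linkEmbed L p.2.1‖ ^ 2 ≤ T} ∩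
          {p | Ω (linkEmbed L p.1) ≠ 0 ∧ Ω (linkEmbed L p.2.1) ≠ 0 ∧ fpWeight L ε p.2.2 ≠ 0}),
        fpTriple L β Ω (fpWeight L ε) 1 1 p * (1 + β * kinDefect L (orthoTube L 1 p.1) (orthoTube L 1 p.2.1) p.2.2 + β * ‖linkEmbed L p.1‖ ^ 2 + β * ‖linkEmbed L p.2.1‖ ^ 2) ^ 4
        ∂((orthoTransverse L).prod ((orthoTransverse L).prod (gaugeMeasure L))) ≤
      Ξ * ∫ p, fpTriple L β Ω (fpWeight L ε) 1 1 p ∂((orthoTransverse L).prod ((orthoTransverse L).prod (gaugeMeasure L))))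
    (htail1 : ∫ p in ({p : (Edge 3 L → Fin 3 → ℝ) × ((Edge 3 L → Fin 3 → ℝ) × (Site 3 L → SU2)) | β * kinDefect L (orthoTube L 1 p.1) (orthoTube L 1 p.2.1) p.2.2 ≤ T} ∩
          {p | β * ‖linkEmbed L p.1‖ ^ 2 ≤ T} ∩ {p | β * ‖linkEmbed L p.2.1‖ ^ 2 ≤ T} ∩
          {p | Ω (linkEmbed L p.1) ≠ 0 ∧ Ω (linkEmbed L p.2.1) ≠ 0 ∧ fpWeight L ε p.2.2 ≠ 0})ᶜ,
        fpTriple L β Ω (fpWeight L ε) 1 1 p ∂((orthoTransverse L).prod ((orthoTransverse L).prod (gaugeMeasure L))) ≤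
      η * ∫ p, fpTriple L β Ω (fpWeight L ε) 1 1 p ∂((orthoTransverse L).prod ((orthoTransverse L).prod (gaugeMeasure L))))
    (htailu : ∀ d : SU2, (∫ p in ({p : (Edge 3 L → Fin 3 → ℝ) × ((Edge 3 L → Fin 3 → ℝ) × (Site 3 L → SU2)) | β * kinDefect L (orthoTube L 1 p.1) (orthoTube L 1 p.2.1) p.2.2 ≤ T} ∩
          {p | β * ‖linkEmbed L p.1‖ ^ 2 ≤ T} ∩ {p | β * ‖linkEmbed L p.2.1‖ ^ 2 ≤ T} ∩
          {p | Ω (linkEmbed L p.1) ≠ 0 ∧ Ω (linkEmbed L p.2.1) ≠ 0 ∧ fpWeight L ε p.2.2 ≠ 0})ᶜ,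
        fpTriple L β Ω (fpWeight L ε) (gaugeTransform (fun _ : Site 3 1 => d) u) (gaugeTransform (fun _ : Site 3 1 => d) u) p
        ∂((orthoTransverse L).prod ((orthoTransverse L).prod (gaugeMeasure L)))) / transferKernel su2Rep ((L : ℝ) ^ 3 * β) u u ≤
      η * ((∫ p, fpTriple L β Ω (fpWeight L ε) 1 1 p ∂((orthoTransverse L).prod ((orthoTransverse L).prod (gaugeMeasure L)))) /
        transferKernel su2Rep ((L : ℝ) ^ 3 * β) (1 : GaugeConfig 3 1 SU2) 1)) :
    (1 - ((orbitDist u ^ 2 * (48 * ((Fintype.card (Edge 3 L) : ℝ) * (24302 * (L : ℝ) ^ 2 + 6 * (β * ε ^ 2))) + 72500000 * (Fintype.card (Plaquette 3 L × Fin 3) : ℝ)) +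
          25 * ((L : ℝ) ^ 3 * (12 * orbitDist u ^ 4)) * (Fintype.card (Plaquette 3 L × Fin 3) : ℝ) + 3456 * (Fintype.card (Plaquette 3 L) : ℝ) * Real.sqrt ((L : ℝ) ^ 3 * (12 * orbitDist u ^ 4))) +
        4 * (Fintype.card (Plaquette 3 L) : ℝ) * (((L : ℝ) ^ 3 * (12 * orbitDist u ^ 4)) * (14688 * (Real.sqrt β)⁻¹ + 1401138 * β⁻¹) + 700000 * orbitDist u * (Real.sqrt β)⁻¹)) * Ξ - η) *
        (fpBOKernel L β Ω (fpWeight L ε) 1 1 / transferKernel su2Rep ((L : ℝ) ^ 3 * β) (1 : GaugeConfig 3 1 SU2) 1) ≤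
        fpBOKernel L β Ω (fpWeight L ε) u u / transferKernel su2Rep ((L : ℝ) ^ 3 * β) u u ∧
      fpBOKernel L β Ω (fpWeight L ε) u u / transferKernel su2Rep ((L : ℝ) ^ 3 * β) u u ≤
        (1 + ((orbitDist u ^ 2 * (48 * ((Fintype.card (Edge 3 L) : ℝ) * (24302 * (L : ℝ) ^ 2 + 6 * (β * ε ^ 2))) + 72500000 * (Fintype.card (Plaquette 3 L × Fin 3) : ℝ)) +
            25 * ((L : ℝ) ^ 3 * (12 * orbitDist u ^ 4)) * (Fintype.card (Plaquette 3 L × Fin 3) : ℝ) + 3456 * (Fintype.card (Plaquette 3 L) : ℝ) * Real.sqrt ((L : ℝ) ^ 3 * (12 * orbitDist u ^ 4))) +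
          4 * (Fintype.card (Plaquette 3 L) : ℝ) * (((L : ℝ) ^ 3 * (12 * orbitDist u ^ 4)) * (14688 * (Real.sqrt β)⁻¹ + 1401138 * β⁻¹) + 700000 * orbitDist u * (Real.sqrt β)⁻¹)) * Ξ +
          Real.exp 1 * ((orbitDist u * (24 * ((Fintype.card (Edge 3 L) : ℝ) * (24302 * (L : ℝ) ^ 2 + 6 * (β * ε ^ 2))) + 80 * (Fintype.card (Plaquette 3 L × Fin 3) : ℝ))) +
            ((orbitDist u ^ 2 * (48 * ((Fintype.card (Edge 3 L) : ℝ) * (24302 * (L : ℝ) ^ 2 + 6 * (β * ε ^ 2))) + 72500000 * (Fintype.card (Plaquette 3 L × Fin 3) : ℝ)) +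
              25 * ((L : ℝ) ^ 3 * (12 * orbitDist u ^ 4)) * (Fintype.card (Plaquette 3 L × Fin 3) : ℝ) + 3456 * (Fintype.card (Plaquette 3 L) : ℝ) * Real.sqrt ((L : ℝ) ^ 3 * (12 * orbitDist u ^ 4)))) +
            4 * (Fintype.card (Plaquette 3 L) : ℝ) * (((L : ℝ) ^ 3 * (12 * orbitDist u ^ 4)) * (14688 * (Real.sqrt β)⁻¹ + 1401138 * β⁻¹) + 700000 * orbitDist u * (Real.sqrt β)⁻¹)) ^ 2 * Ξ + η) *
        (fpBOKernel L β Ω (fpWeight L ε) 1 1 / transferKernel su2Rep ((L : ℝ) ^ 3 * β) (1 : GaugeConfig 3 1 SU2) 1) := by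
  have hβ0 : 0 < β := by linarith
  have hle := measurable_linkEmbed L
  -- abbreviations
  set τu : ℝ := orbitDist u with hτu
  set σ : ℝ := (L : ℝ) ^ 3 * (12 * orbitDist u ^ 4) with hσdef
  set cK : ℝ := (Fintype.card (Edge 3 L) : ℝ) * (24302 * (L : ℝ) ^ 2 + 6 * (β * ε ^ 2)) with hcK
  set N3 : ℝ := (Fintype.card (Plaquette 3 L × Fin 3) : ℝ) with hN3
  set NP : ℝ := (Fintype.card (Plaquette 3 L) : ℝ) with hNP
  set a₁ : ℝ := τu * (24 * cK + 80 * N3) with ha₁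
  set a₂ : ℝ := τu ^ 2 * (48 * cK + 72500000 * N3) + 25 * σ * N3 + 3456 * NP * Real.sqrt σ with ha₂
  set aq : ℝ := 4 * NP * (σ * (14688 * (Real.sqrt β)⁻¹ + 1401138 * β⁻¹) + 700000 * τu * (Real.sqrt β)⁻¹) with haq
  -- the slow datum
  have hτu0 : 0 ≤ τu := orbitDist_nonneg u
  have hqu : ∀ k : Fin 3, ‖su2Quat (u (0, k)) - 1‖ ≤ τu := fun k => norm_su2Quat_sub_one_le_orbitDist u (0, k)
  have hu2 : ∀ k : Fin 3, ∑ a, vecPart (u (0, k)) a ^ 2 ≤ τu ^ 2 := fun k =>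
    (sum_sq_vecPart_le_norm_sub_one_sq (u (0, k))).trans (pow_le_pow_left₀ (norm_nonneg _) (hqu k) 2)
  have hS1 : (L : ℝ) ^ 3 * wilsonAction su2Rep u ≤ σ := by
    rw [hσdef]
    exact mul_le_mul_of_nonneg_left (wilsonAction_one_site_le u (fun e => by
      have : e = (0, e.2) := by ext <;> simp [Subsingleton.elim e.1 0]
      rw [this]; exact hqu e.2)) (by positivity)
  have hσ0 : 0 ≤ σ := by rw [hσdef]; positivity
  -- nonnegativity of the coefficients
  have hcK0 : 0 ≤ cK := by rw [hcK]; positivity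
  have hN30 : 0 ≤ N3 := Nat.cast_nonneg _
  have hNP0 : 0 ≤ NP := Nat.cast_nonneg _
  have hsβi : 0 ≤ (Real.sqrt β)⁻¹ := inv_nonneg.mpr (Real.sqrt_nonneg _)
  have hβi : 0 ≤ β⁻¹ := inv_nonneg.mpr hβ0.le
  have ha₁0 : 0 ≤ a₁ := by rw [ha₁]; positivity
  have ha₂0 : 0 ≤ a₂ := by rw [ha₂]; have := Real.sqrt_nonneg σ; positivity
  have haq0 : 0 ≤ aq := by rw [haq]; positivity
  -- the core set is measurable
  have hNm := ((continuous_kinDefect_joint (L := L)).measurable.comp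
    (((measurable_orthoTube_right (L := L) 1).comp measurable_fst).prodMk
      (((measurable_orthoTube_right (L := L) 1).comp (measurable_fst.comp measurable_snd)).prodMk (measurable_snd.comp measurable_snd)))).const_mul β
  have hA : MeasurableSet {p : (Edge 3 L → Fin 3 → ℝ) × ((Edge 3 L → Fin 3 → ℝ) × (Site 3 L → SU2)) | β * kinDefect L (orthoTube L 1 p.1) (orthoTube L 1 p.2.1) p.2.2 ≤ T} :=
    measurableSet_le hNm measurable_const
  have hB : MeasurableSet {p : (Edge 3 L → Fin 3 → ℝ) × ((Edge 3 L → Fin 3 → ℝ) × (Site 3 L → SU2)) | β * ‖linkEmbed L p.1‖ ^ 2 ≤ T} :=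
    measurableSet_le (((hle.comp measurable_fst).norm.pow_const 2).const_mul β) measurable_const
  have hC : MeasurableSet {p : (Edge 3 L → Fin 3 → ℝ) × ((Edge 3 L → Fin 3 → ℝ) × (Site 3 L → SU2)) | β * ‖linkEmbed L p.2.1‖ ^ 2 ≤ T} :=
    measurableSet_le (((hle.comp (measurable_fst.comp measurable_snd)).norm.pow_const 2).const_mul β) measurable_const
  have hD : MeasurableSet {p : (Edge 3 L → Fin 3 → ℝ) × ((Edge 3 L → Fin 3 → ℝ) × (Site 3 L → SU2)) | Ω (linkEmbed L p.1) ≠ 0 ∧ Ω (linkEmbed L p.2.1) ≠ 0 ∧ fpWeight L ε p.2.2 ≠ 0} := by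
    have h1 : Measurable fun p : (Edge 3 L → Fin 3 → ℝ) × ((Edge 3 L → Fin 3 → ℝ) × (Site 3 L → SU2)) => Ω (linkEmbed L p.1) := hΩm.comp (hle.comp measurable_fst)
    have h2 : Measurable fun p : (Edge 3 L → Fin 3 → ℝ) × ((Edge 3 L → Fin 3 → ℝ) × (Site 3 L → SU2)) => Ω (linkEmbed L p.2.1) :=
      hΩm.comp (hle.comp (measurable_fst.comp measurable_snd))
    have h3 : Measurable fun p : (Edge 3 L → Fin 3 → ℝ) × ((Edge 3 L → Fin 3 → ℝ) × (Site 3 L → SU2)) => fpWeight L ε p.2.2 :=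
      (measurable_fpWeight L ε).comp (measurable_snd.comp measurable_snd)
    exact ((h1 (measurableSet_singleton 0).compl).inter ((h2 (measurableSet_singleton 0).compl).inter (h3 (measurableSet_singleton 0).compl)))
  have hS := ((hA.inter hB).inter hC).inter hD
  -- pointwise data on the core
  have hcore : ∀ p ∈ ({p : (Edge 3 L → Fin 3 → ℝ) × ((Edge 3 L → Fin 3 → ℝ) × (Site 3 L → SU2)) | β * kinDefect L (orthoTube L 1 p.1) (orthoTube L 1 p.2.1) p.2.2 ≤ T} ∩
          {p | β * ‖linkEmbed L p.1‖ ^ 2 ≤ T} ∩ {p | β * ‖linkEmbed L p.2.1‖ ^ 2 ≤ T} ∩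
          {p | Ω (linkEmbed L p.1) ≠ 0 ∧ Ω (linkEmbed L p.2.1) ≠ 0 ∧ fpWeight L ε p.2.2 ≠ 0}),
      p.1 ∈ capBalancedSet L ∧ p.2.1 ∈ capBalancedSet L ∧ ‖linkEmbed L p.1‖ ≤ rT ∧ ‖linkEmbed L p.2.1‖ ≤ rT ∧ colourMean L p.2.2 ∈ fpBall ε ∧
        kinDefect L (orthoTube L 1 p.1) (orthoTube L 1 p.2.1) p.2.2 ≤ T / β ∧
        3 * L * (Real.sqrt (kinDefect L (orthoTube L 1 p.1) (orthoTube L 1 p.2.1) p.2.2) + 5 * Real.sqrt 2 * ‖linkEmbed L p.1‖ + Real.sqrt 2 * ‖linkEmbed L p.2.1‖) < 1 := by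
    rintro p ⟨⟨⟨hpA, hpB⟩, hpC⟩, ⟨hv0, hv'0, hg0⟩⟩
    have hvr : ‖linkEmbed L p.1‖ ≤ rT := hrT _ (norm_nonneg _) hpB
    have hv'r : ‖linkEmbed L p.2.1‖ ≤ rT := hrT _ (norm_nonneg _) hpC
    have hkin : kinDefect L (orthoTube L 1 p.1) (orthoTube L 1 p.2.1) p.2.2 ≤ T / β := by
      rw [le_div_iff₀ hβ0]; simp only [Set.mem_setOf_eq] at hpA; linarith
    have hW : colourMean L p.2.2 ∈ fpBall ε := by
      by_contra hno; apply hg0; unfold fpWeight; rw [Set.indicator_of_notMem hno]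
    have hsq : Real.sqrt (kinDefect L (orthoTube L 1 p.1) (orthoTube L 1 p.2.1) p.2.2) ≤ Real.sqrt (T / β) := Real.sqrt_le_sqrt hkin
    have hs2 : 0 ≤ Real.sqrt 2 := Real.sqrt_nonneg _
    refine ⟨hΩc _ hv0, hΩc _ hv'0, hvr, hv'r, hW, hkin, ?_⟩
    have hL0 : (0 : ℝ) ≤ 3 * L := by positivity
    calc 3 * L * (Real.sqrt (kinDefect L (orthoTube L 1 p.1) (orthoTube L 1 p.2.1) p.2.2) + 5 * Real.sqrt 2 * ‖linkEmbed L p.1‖ + Real.sqrt 2 * ‖linkEmbed L p.2.1‖)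
        ≤ 3 * L * (Real.sqrt (T / β) + 5 * Real.sqrt 2 * rT + Real.sqrt 2 * rT) := by
          refine mul_le_mul_of_nonneg_left ?_ hL0
          nlinarith [hsq, hvr, hv'r, hs2]
      _ < 1 := hsmallT
  -- the two level bounds on the core
  have hE1 : ∀ p ∈ ({p : (Edge 3 L → Fin 3 → ℝ) × ((Edge 3 L → Fin 3 → ℝ) × (Site 3 L → SU2)) | β * kinDefect L (orthoTube L 1 p.1) (orthoTube L 1 p.2.1) p.2.2 ≤ T} ∩
          {p | β * ‖linkEmbed L p.1‖ ^ 2 ≤ T} ∩ {p | β * ‖linkEmbed L p.2.1‖ ^ 2 ≤ T} ∩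
          {p | Ω (linkEmbed L p.1) ≠ 0 ∧ Ω (linkEmbed L p.2.1) ≠ 0 ∧ fpWeight L ε p.2.2 ≠ 0}), ∀ d : SU2,
      |diagX1 L β (slowLin (gaugeTransform (fun _ : Site 3 1 => d) u)) p.1 p.2.1 p.2.2| ≤
        a₁ * (1 + β * kinDefect L (orthoTube L 1 p.1) (orthoTube L 1 p.2.1) p.2.2 + β * ‖linkEmbed L p.1‖ ^ 2 + β * ‖linkEmbed L p.2.1‖ ^ 2) := by
    intro p hp d
    obtain ⟨hvc, hv'c, _, _, hW, _, hsmall⟩ := hcore p hp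
    have h := diagX1_conj_le_levels (L := L) hβ0.le u hτu0 hu2 (sum_sq_le_one_of_cap L hvc.2) (sum_sq_le_one_of_cap L hv'c.2) hW hsmall d
    rw [ha₁, hcK, hN3]; exact h
  have hE2 : ∀ p ∈ ({p : (Edge 3 L → Fin 3 → ℝ) × ((Edge 3 L → Fin 3 → ℝ) × (Site 3 L → SU2)) | β * kinDefect L (orthoTube L 1 p.1) (orthoTube L 1 p.2.1) p.2.2 ≤ T} ∩
          {p | β * ‖linkEmbed L p.1‖ ^ 2 ≤ T} ∩ {p | β * ‖linkEmbed L p.2.1‖ ^ 2 ≤ T} ∩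
          {p | Ω (linkEmbed L p.1) ≠ 0 ∧ Ω (linkEmbed L p.2.1) ≠ 0 ∧ fpWeight L ε p.2.2 ≠ 0}), ∀ d : SU2,
      |diagX L β (gaugeTransform (fun _ : Site 3 1 => d) u) p.1 p.2.1 p.2.2 - diagX1 L β (slowLin (gaugeTransform (fun _ : Site 3 1 => d) u)) p.1 p.2.1 p.2.2| ≤
        a₂ * (1 + β * kinDefect L (orthoTube L 1 p.1) (orthoTube L 1 p.2.1) p.2.2 + β * ‖linkEmbed L p.1‖ ^ 2 + β * ‖linkEmbed L p.2.1‖ ^ 2) +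
          aq * (1 + β * ‖linkEmbed L p.1‖ ^ 2 + β * ‖linkEmbed L p.2.1‖ ^ 2) ^ 2 := by
    intro p hp d
    obtain ⟨hvc, hv'c, hvr, hv'r, hW, _, hsmall⟩ := hcore p hp
    have hrr : ‖linkEmbed L p.1‖ + ‖linkEmbed L p.2.1‖ ≤ 1 / 30 := by linarith
    have h := diagX_conj_sub_diagX1_le_levels (L := L) hβ u hτu0 hu40 hu2 hσ2 hσ0 hS1 hvc hv'c hrr hW hsmall d
    rw [ha₂, haq, hcK, hN3, hNP]; exact h
  -- the sup bound on the core
  have hB' : ∀ p ∈ ({p : (Edge 3 L → Fin 3 → ℝ) × ((Edge 3 L → Fin 3 → ℝ) × (Site 3 L → SU2)) | β * kinDefect L (orthoTube L 1 p.1) (orthoTube L 1 p.2.1) p.2.2 ≤ T} ∩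
          {p | β * ‖linkEmbed L p.1‖ ^ 2 ≤ T} ∩ {p | β * ‖linkEmbed L p.2.1‖ ^ 2 ≤ T} ∩
          {p | Ω (linkEmbed L p.1) ≠ 0 ∧ Ω (linkEmbed L p.2.1) ≠ 0 ∧ fpWeight L ε p.2.2 ≠ 0}),
      a₁ * (1 + β * kinDefect L (orthoTube L 1 p.1) (orthoTube L 1 p.2.1) p.2.2 + β * ‖linkEmbed L p.1‖ ^ 2 + β * ‖linkEmbed L p.2.1‖ ^ 2) +
        (a₂ * (1 + β * kinDefect L (orthoTube L 1 p.1) (orthoTube L 1 p.2.1) p.2.2 + β * ‖linkEmbed L p.1‖ ^ 2 + β * ‖linkEmbed L p.2.1‖ ^ 2) +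
          aq * (1 + β * ‖linkEmbed L p.1‖ ^ 2 + β * ‖linkEmbed L p.2.1‖ ^ 2) ^ 2) ≤ 1 := by
    rintro p ⟨⟨⟨hpA, hpB⟩, hpC⟩, _⟩
    simp only [Set.mem_setOf_eq] at hpA hpB hpC
    have hk0 : 0 ≤ β * kinDefect L (orthoTube L 1 p.1) (orthoTube L 1 p.2.1) p.2.2 := mul_nonneg hβ0.le (kinDefect_nonneg _ _ _)
    have hv0 : 0 ≤ β * ‖linkEmbed L p.1‖ ^ 2 := by positivity
    have hv'0 : 0 ≤ β * ‖linkEmbed L p.2.1‖ ^ 2 := by positivity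
    have hΛ : 1 + β * kinDefect L (orthoTube L 1 p.1) (orthoTube L 1 p.2.1) p.2.2 + β * ‖linkEmbed L p.1‖ ^ 2 + β * ‖linkEmbed L p.2.1‖ ^ 2 ≤ 1 + 3 * T := by linarith
    have hQ : (1 + β * ‖linkEmbed L p.1‖ ^ 2 + β * ‖linkEmbed L p.2.1‖ ^ 2) ^ 2 ≤ (1 + 2 * T) ^ 2 := pow_le_pow_left₀ (by positivity) (by linarith) 2
    have h1 := mul_le_mul_of_nonneg_left hΛ ha₁0
    have h2 := mul_le_mul_of_nonneg_left hΛ ha₂0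
    have h3 := mul_le_mul_of_nonneg_left hQ haq0
    have hs : a₁ * (1 + 3 * T) + a₂ * (1 + 3 * T) + aq * (1 + 2 * T) ^ 2 ≤ 1 := by linarith [hsum]
    linarith
  exact fpBOKernel_diag_two_sided_of_levelBounds (L := L) hΩm hCΩ hΩ0 hΩinv ε u hS ha₁0 ha₂0 haq0 hE1 hE2 hB' hβ0.le hM₂i hMRi hΛi hΞ htail1 htailu

end Summit.QuantumFields.YangMills.Theorems.FemtoTransferGap.RateTube

end
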